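import Mathlib
import Literature.Analysis.FluidPDE.CheskidovFriedlander2009.FixedPointExistence
import HarnessLib

/-!
# Cheskidov–Friedlander 2009, Thm. 3.4: the non-negativity hypothesis on the fixed point is
# necessary — a negative `ℓ²` fixed point

Cheskidov–Friedlander, Physica D 238 (2009) 783–787 = arXiv:0810.3718v1.  Thm. 3.4 (p. 7) reads
"Let `α ∈ l²` be a fixed point of (3.1) …", where (3.1) carries the standing hypothesis "the
initial data is assumed to be `a(0) ∈ l²`, `a_j(0) ≥ 0` for all `j`" (p. 7), and Lemma 2.1 (p. 4)
asserts `A_j > 0` for the steady states considered.  The transcription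
`CheskidovFriedlander2009_globalAttractor` (`VanishingViscosityLimit.lean`) therefore carries the
hypothesis `∀ j, 0 ≤ α j`.  This file documents that the hypothesis is NECESSARY: at `c = 5/2`,
`ν = f₀ = √2/4`, the sequence `α⁻_j = −(√2/2)^j` is an explicit `ℓ²` (indeed `H¹`) zero of the
vector field with NEGATIVE entries (`isFixedPoint_negGeometric`; in general
`α⁻_j = −K(2^{2−c})^j` solves the unforced shells identically whenever `2 < c < 3`).  Since the
non-negative fixed point also exists (`exists_isFixedPoint`) and differs from `α⁻`, a sign-free
reading of Thm. 3.4 ("every `ℓ²` zero attracts every solution with non-negative datum") is false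
for `c ∈ (2, 5/2]`; an earlier sign-free transcription was refuted this way and removed.

## References
* [CheskidovFriedlander2009] A. Cheskidov, S. Friedlander, The vanishing viscosity limit for a
  dyadic model, Physica D 238 (2009) 783–787, (3.1) and Thm 3.4 p. 7, Lemma 2.1 p. 4.
-/

noncomputable section

open Set Filter

namespace Literature.Analysis.FluidPDE.CheskidovFriedlander2009

/-- `2^{5/2} = 4√2`. [cite: CheskidovFriedlander2009, §1 (1.2) p.2] -/
theorem two_rpow_five_halves : (2 : ℝ) ^ (5 / 2 : ℝ) = 4 * Real.sqrt 2 := by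
  rw [show (5 / 2 : ℝ) = (2 : ℝ) + 1 / 2 by norm_num, Real.rpow_add two_pos, Real.rpow_two,
    ← Real.sqrt_eq_rpow]
  norm_num

/-- **A negative `ℓ²` fixed point of the viscous dyadic model**: at `c = 5/2`, `ν = √2/4`,
`f₀ = √2/4`, the sequence `α⁻_j = −(√2/2)^j` is an `ℓ²` zero of the vector field (1.2)/(3.1)
(all shells balance: `ν2^{2(j+1)}(√2/2)^{j+1}·… `, see the module docstring).  Hence the sign
condition of (3.1) cannot be dropped from Thm. 3.4. [cite: CheskidovFriedlander2009, (3.1) and Thm 3.4 p.7] -/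
theorem isFixedPoint_negGeometric :
    IsFixedPoint (5 / 2) (Real.sqrt 2 / 4) (force (Real.sqrt 2 / 4))
      (fun j => -((Real.sqrt 2 / 2) ^ j)) := by
  set r : ℝ := Real.sqrt 2 with hrdef
  have hr : r ^ 2 = 2 := Real.sq_sqrt (by norm_num)
  have hr4 : r ^ 4 = 4 := by nlinarith [hr]
  have hp : (2 : ℝ) ^ (5 / 2 : ℝ) = 4 * r := two_rpow_five_halves
  refine ⟨?_, fun j => ?_⟩
  · -- `Σ ((√2/2)^j)² = Σ (1/2)^j < ∞`
    have hgeom : Summable fun j : ℕ => (1 / 2 : ℝ) ^ j :=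
      summable_geometric_of_lt_one (by norm_num) (by norm_num)
    refine hgeom.congr fun j => ?_
    rw [neg_sq, ← pow_mul, mul_comm j 2, pow_mul]
    congr 1
    rw [div_pow, hr]
    norm_num
  · cases j with
    | zero =>
      simp only [rhs, force_zero, pow_zero, pow_one]
      ring
    | succ j =>
      simp only [rhs, force_succ, add_zero, hp]
      have hr3 : r ^ 3 = 2 * r := by linear_combination r * hr
      have aux : (4 * r) ^ j * ((r / 2) ^ j) ^ 2 = (4 : ℝ) ^ j * (r / 2) ^ j := by
        rw [show ((r / 2) ^ j) ^ 2 = ((r / 2) ^ 2) ^ j by rw [← pow_mul, ← pow_mul, mul_comm],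
          ← mul_pow, ← mul_pow]
        congr 1
        linear_combination hr3
      rw [show (2 : ℝ) ^ (2 * (j + 1)) = 4 * 4 ^ j by rw [pow_mul]; norm_num [pow_succ]; ring,
        pow_succ (4 * r) j, pow_succ (r / 2) j,
        show (r / 2) ^ (j + 2) = (r / 2) ^ j * (r / 2) ^ 2 by rw [pow_add]]
      linear_combination (-1 : ℝ) * aux + ((4 : ℝ) ^ j * (r / 2) ^ j / 2) * hr
        + (-((4 * r) ^ j * ((r / 2) ^ j) ^ 2) / 2) * hr4

/-- Negative `ℓ²` fixed points exist (at `c = 5/2`, for suitable `ν, f₀ > 0`).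
[cite: CheskidovFriedlander2009, (3.1) and Thm 3.4 p.7] -/
theorem exists_isFixedPoint_neg :
    ∃ (ν f₀ : ℝ) (α : ℕ → ℝ), 0 < ν ∧ 0 < f₀ ∧ IsFixedPoint (5 / 2) ν (force f₀) α ∧ α 0 < 0 :=
  ⟨Real.sqrt 2 / 4, Real.sqrt 2 / 4, fun j => -((Real.sqrt 2 / 2) ^ j), by positivity,
    by positivity, isFixedPoint_negGeometric, by norm_num⟩

end Literature.Analysis.FluidPDE.CheskidovFriedlander2009

end
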